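import Mathlib.Analysis.Normed.Ring.Basic
import Mathlib.NumberTheory.NumberField.InfinitePlace.Basic
import Literature.NumberTheory.Transcendental.NesterenkoElimination
import HarnessLib

/-!
# Small value estimates at rational translates (Nguyen–Roy 2016) — proofs, V: Liouville's inequality for the projective distance

Fifth proofs file towards `Literature.NumberTheory.Transcendental.nguyenRoy2016_thm_1` (Nguyen–Roy,
IJNT 12 (2016) = arXiv:1412.5163). We PROVE the diophantine core of **Proposition 12** of the
paper (§4): a Liouville-type lower bound for the projective distances between the complex
conjugates of two non-proportional algebraic points.

Let `K` be a number field, `γ, γ* ∈ K^{m+1}` with `γ ∧ γ* ≠ 0`, and for an embedding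
`σ : K → ℂ` write `dist(σγ, σγ*) = max_{i<j} |σ(γᵢγ*ⱼ − γⱼγ*ᵢ)| / (max |σγᵢ| · max |σγ*ⱼ|)` for the
projective distance of the paper (= the tree's `Nesterenko.projDist`). The proof of Prop. 12
(displayed chain on p. 10 of the arXiv text) runs: at every place `v` of `K`,
`‖γ ∧ γ*‖_v ≤ ‖γ‖_v ‖γ*‖_v` if `v ∤ ∞` and `≤ 2 ‖γ‖_v ‖γ*‖_v` if `v | ∞`; summing with the weights
`[K_v : ℚ_v]` and using `h(γ ∧ γ*) ≥ 0` gives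
`∑_{σ} log dist(σγ, σγ*) ≥ −(h_K(γ) + h_K(γ*))`, the sum over ALL embeddings and `h_K` the
logarithmic height relative to `K` (`= [K:ℚ] ×` the absolute Weil height; Mathlib's
`Height.logHeight`); and since every distance is `≤ 2`, for any set `S` of embeddings
`∑_{σ ∈ S} log dist(σγ, σγ*) ≥ −h_K(γ) − h_K(γ*) − [K:ℚ] log 2`. This is what we prove
(`NguyenRoy.one_le_two_pow_mul_mulHeight_mul_prod_projDist`, multiplicative form, and
`NguyenRoy.neg_logHeight_le_sum_log_projDist`, logarithmic form). The remaining content of Prop. 12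
as printed (orbits of `Gal(ℚ̄/ℚ)` on `Z × Z*` for `0`-dimensional `ℚ`-subvarieties `Z, Z*` of `ℙ²`,
and `|h(Z) − deg(Z) h_abs(α)| ≤ 3 deg(Z)`) is bookkeeping on top of this inequality and is not
formalised here.

## Main results

* `NguyenRoy.wedge γ δ` — the coordinates `γᵢδⱼ − γⱼδᵢ`, `i < j`, of `γ ∧ δ`.
* `NguyenRoy.projDist_comp_embedding` — `dist(σγ, σδ) = max_v |γ∧δ| / max_v |γ ⊗ δ|` at the place
  `v = |σ ·|`.
* `NguyenRoy.one_le_two_pow_mul_mulHeight_mul_prod_projDist` — for `γ ∧ δ ≠ 0` and any finset `S`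
  of embeddings `K →+* ℂ`: `1 ≤ 2^{[K:ℚ]} H_K(γ) H_K(δ) ∏_{σ ∈ S} dist(σγ, σδ)`.
* `NguyenRoy.neg_logHeight_le_sum_log_projDist` — the same in logarithmic form:
  `−h_K(γ) − h_K(δ) − [K:ℚ] log 2 ≤ ∑_{σ ∈ S} log dist(σγ, σδ)`.

## References

* [NguyenRoy2016] N. A. V. Nguyen, D. Roy, IJNT 12 (2016) = arXiv:1412.5163, §4, Proposition 12
  and its proof.
-/

noncomputable section

open NumberField Height Finset
open Literature.NumberTheory.Transcendental.Nesterenko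

namespace Literature.NumberTheory.Transcendental

namespace NguyenRoy

variable {K : Type*} [Field K] {m : ℕ}

/-! ### Wedge coordinates and local estimates -/

/-- The coordinates `γᵢδⱼ − γⱼδᵢ` (`i < j`) of `γ ∧ δ ∈ ⋀² K^{m+1}`.
[cite: NguyenRoy2016, §2 (the distance) and Prop. 12 (proof)] -/
def wedge {R : Type*} [CommRing R] (γ δ : Fin (m + 1) → R) : SkewIdx m → R :=
  fun p => γ p.1.1 * δ p.1.2 - γ p.1.2 * δ p.1.1

/-- `wedge` commutes with ring homomorphisms. [folklore] -/
theorem map_wedge {R S : Type*} [CommRing R] [CommRing S] (f : R →+* S) (γ δ : Fin (m + 1) → R)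
    (p : SkewIdx m) : f (wedge γ δ p) = wedge (f ∘ γ) (f ∘ δ) p := by
  simp [wedge]

/-- If `γ ∧ δ ≠ 0` then `γ ≠ 0`. [folklore] -/
theorem left_ne_zero_of_wedge_ne_zero {R : Type*} [CommRing R] {γ δ : Fin (m + 1) → R}
    (h : wedge γ δ ≠ 0) : γ ≠ 0 := by
  rintro rfl; exact h (funext fun p => by simp [wedge])

/-- If `γ ∧ δ ≠ 0` then `δ ≠ 0`. [folklore] -/
theorem right_ne_zero_of_wedge_ne_zero {R : Type*} [CommRing R] {γ δ : Fin (m + 1) → R}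
    (h : wedge γ δ ≠ 0) : δ ≠ 0 := by
  rintro rfl; exact h (funext fun p => by simp [wedge])

/-- **Archimedean local estimate**: `max |γ∧δ|_v ≤ 2 max_{i,j} |γᵢδⱼ|_v` for any absolute value.
[cite: NguyenRoy2016, Prop. 12 (proof, "≤ 2 if v | ∞")] -/
theorem iSup_wedge_le_two_mul (v : AbsoluteValue K ℝ) (γ δ : Fin (m + 1) → K) :
    ⨆ p, v (wedge γ δ p) ≤ 2 * ⨆ a : Fin (m + 1) × Fin (m + 1), v (γ a.1 * δ a.2) := by
  have h0 : 0 ≤ ⨆ a : Fin (m + 1) × Fin (m + 1), v (γ a.1 * δ a.2) :=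
    Real.iSup_nonneg fun a => v.nonneg _
  rcases isEmpty_or_nonempty (SkewIdx m) with hE | hE
  · rw [Real.iSup_of_isEmpty]; linarith
  refine ciSup_le fun p => ?_
  calc v (wedge γ δ p) ≤ v (γ p.1.1 * δ p.1.2) + v (γ p.1.2 * δ p.1.1) := by
        rw [wedge]; exact v.sub_le_add _ _
    _ ≤ (⨆ a : Fin (m + 1) × Fin (m + 1), v (γ a.1 * δ a.2)) +
        ⨆ a : Fin (m + 1) × Fin (m + 1), v (γ a.1 * δ a.2) :=
        add_le_add (Finite.le_ciSup_of_le (p.1.1, p.1.2) le_rfl)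
          (Finite.le_ciSup_of_le (p.1.2, p.1.1) le_rfl)
    _ = _ := by ring

/-- Positivity of `max_{i,j} |γᵢδⱼ|_v` for `γ, δ ≠ 0`. [folklore] -/
theorem iSup_mul_pos (v : AbsoluteValue K ℝ) {γ δ : Fin (m + 1) → K} (hγ : γ ≠ 0) (hδ : δ ≠ 0) :
    0 < ⨆ a : Fin (m + 1) × Fin (m + 1), v (γ a.1 * δ a.2) := by
  obtain ⟨i, hi⟩ := Function.ne_iff.mp hγ
  obtain ⟨j, hj⟩ := Function.ne_iff.mp hδ
  exact lt_of_lt_of_le (v.pos (mul_ne_zero hi hj)) (Finite.le_ciSup_of_le (i, j) le_rfl)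

/-! ### The projective distance at an embedding -/

/-- The sup norm of the image of a tuple under an embedding is the `max` of the place.
[folklore] -/
theorem norm_comp_embedding (σ : K →+* ℂ) (x : Fin (m + 1) → K) :
    ‖(σ ∘ x : Fin (m + 1) → ℂ)‖ = ⨆ i, (InfinitePlace.mk σ) (x i) := by
  rw [Pi.norm_def, Finset.sup_univ_eq_ciSup, NNReal.coe_iSup]
  rfl

/-- **The distance at an embedding**: `dist(σγ, σδ) = max_v|γ ∧ δ| / max_v|γ ⊗ δ|` for the
infinite place `v = |σ ·|`. [cite: NguyenRoy2016, §2 and Prop. 12 (proof)] -/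
theorem projDist_comp_embedding (σ : K →+* ℂ) (γ δ : Fin (m + 1) → K) :
    projDist (σ ∘ γ) (σ ∘ δ) = (⨆ p, (InfinitePlace.mk σ) (wedge γ δ p)) /
      ⨆ a : Fin (m + 1) × Fin (m + 1), (InfinitePlace.mk σ) (γ a.1 * δ a.2) := by
  rw [projDist, norm_comp_embedding, norm_comp_embedding,
    ← Real.iSup_fun_mul_eq_iSup_mul_iSup_of_nonneg (InfinitePlace.mk σ) γ δ,
    Finset.sup_univ_eq_ciSup, NNReal.coe_iSup]
  congr 1
  refine iSup_congr fun p => ?_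
  rw [coe_nnnorm, InfinitePlace.apply, map_wedge]
  rfl

/-- `dist ≤ 2`. [cite: NguyenRoy2016, §2 ("the projective distance between any two points is at most 2")] -/
theorem iSup_wedge_div_le_two (v : InfinitePlace K) {γ δ : Fin (m + 1) → K} (hγ : γ ≠ 0)
    (hδ : δ ≠ 0) :
    (⨆ p, v (wedge γ δ p)) / (⨆ a : Fin (m + 1) × Fin (m + 1), v (γ a.1 * δ a.2)) ≤ 2 := by
  have hB : 0 < ⨆ a : Fin (m + 1) × Fin (m + 1), v (γ a.1 * δ a.2) := iSup_mul_pos v.val hγ hδ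
  rw [div_le_iff₀ hB]
  exact iSup_wedge_le_two_mul v.val γ δ

variable [NumberField K]

/-- **Non-archimedean local estimate**: `max |γ∧δ|_v ≤ max_{i,j} |γᵢδⱼ|_v` at a finite place.
[cite: NguyenRoy2016, Prop. 12 (proof, "≤ 1 if v ∤ ∞")] -/
theorem iSup_wedge_le_finitePlace (v : FinitePlace K) (γ δ : Fin (m + 1) → K) :
    ⨆ p, v (wedge γ δ p) ≤ ⨆ a : Fin (m + 1) × Fin (m + 1), v (γ a.1 * δ a.2) := by
  have h0 : 0 ≤ ⨆ a : Fin (m + 1) × Fin (m + 1), v (γ a.1 * δ a.2) :=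
    Real.iSup_nonneg fun a => apply_nonneg v _
  rcases isEmpty_or_nonempty (SkewIdx m) with hE | hE
  · rw [Real.iSup_of_isEmpty]; exact h0
  refine ciSup_le fun p => ?_
  calc v (wedge γ δ p) ≤ max (v (γ p.1.1 * δ p.1.2)) (v (γ p.1.2 * δ p.1.1)) := by
        rw [wedge, sub_eq_add_neg]
        refine (FinitePlace.add_le v _ _).trans ?_
        rw [map_neg_eq_map]
    _ ≤ _ := max_le (Finite.le_ciSup_of_le (p.1.1, p.1.2) le_rfl)
          (Finite.le_ciSup_of_le (p.1.2, p.1.1) le_rfl)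

/-! ### Finiteness of supports at the finite places -/

/-- For `x ≠ 0`, `v ↦ max_i |x_i|_v` is `1` for almost all finite places `v`. [folklore] -/
theorem hasFiniteMulSupport_iSup_finitePlace {ι : Type*} [Finite ι] {x : ι → K} (hx : x ≠ 0) :
    (fun v : FinitePlace K => ⨆ i, v (x i)).HasFiniteMulSupport := by
  have hne : Nonempty {j // x j ≠ 0} := nonempty_subtype.mpr <| Function.ne_iff.mp hx
  suffices h : (fun v : FinitePlace K => ⨆ i : {j // x j ≠ 0}, v (x i)).HasFiniteMulSupport by
    convert h using 2 with v
    obtain ⟨i, hi⟩ : ∃ j, x j ≠ 0 := Function.ne_iff.mp hx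
    have : Nonempty ι := ⟨i⟩
    refine le_antisymm (ciSup_le fun j => ?_) (ciSup_le fun ⟨j, hj⟩ => Finite.le_ciSup_of_le j le_rfl)
    rcases eq_or_ne (x j) 0 with h | h
    · rw [h, map_zero]
      exact Real.iSup_nonneg' ⟨⟨i, hi⟩, apply_nonneg v _⟩
    · exact Finite.le_ciSup_of_le ⟨j, h⟩ le_rfl
  exact Function.HasFiniteMulSupport.iSup fun j => FinitePlace.hasFiniteMulSupport j.2

/-! ### Liouville's inequality for the projective distance -/

/-- **Product over all embeddings**: `1 ≤ H_K(γ) H_K(δ) ∏_σ dist(σγ, σδ)` when `γ ∧ δ ≠ 0`.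
[cite: NguyenRoy2016, Prop. 12 (proof)] -/
theorem one_le_mulHeight_mul_prod_projDist {γ δ : Fin (m + 1) → K} (hw : wedge γ δ ≠ 0) :
    1 ≤ mulHeight γ * mulHeight δ * ∏ σ : K →+* ℂ, projDist (σ ∘ γ) (σ ∘ δ) := by
  classical
  have hγ := left_ne_zero_of_wedge_ne_zero hw
  have hδ := right_ne_zero_of_wedge_ne_zero hw
  -- the multiplication table `t(i,j) = γᵢ δⱼ` has height `H(γ) H(δ)`
  set t : Fin (m + 1) × Fin (m + 1) → K := fun a => γ a.1 * δ a.2 with ht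
  have htne : t ≠ 0 := by
    obtain ⟨i, hi⟩ := Function.ne_iff.mp hγ
    obtain ⟨j, hj⟩ := Function.ne_iff.mp hδ
    exact Function.ne_iff.mpr ⟨(i, j), mul_ne_zero hi hj⟩
  have hHt : mulHeight t = mulHeight γ * mulHeight δ := mulHeight_fun_mul_eq hγ hδ
  -- local quantities
  set A : InfinitePlace K → ℝ := fun v => ⨆ p, v (wedge γ δ p) with hA
  set B : InfinitePlace K → ℝ := fun v => ⨆ a, v (t a) with hB
  have hBpos : ∀ v, 0 < B v := fun v => iSup_mul_pos v.val hγ hδ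
  have hAnn : ∀ v, 0 ≤ A v := fun v => Real.iSup_nonneg fun p => apply_nonneg v _
  set d : InfinitePlace K → ℝ := fun v => A v / B v with hd
  have hAd : ∀ v, A v = d v * B v := fun v => (div_mul_cancel₀ _ (hBpos v).ne').symm
  -- height of the wedge: `1 ≤ H(γ∧δ) ≤ (∏_v d_v^{mult}) · H(t)`
  have h1 : 1 ≤ mulHeight (wedge γ δ) := one_le_mulHeight _
  have hwedge : mulHeight (wedge γ δ) ≤ (∏ v : InfinitePlace K, d v ^ v.mult) * mulHeight t := by
    rw [NumberField.mulHeight_eq hw, NumberField.mulHeight_eq htne, ← mul_assoc, ← prod_mul_distrib]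
    refine mul_le_mul ?_ ?_ (finprod_nonneg fun v => Real.iSup_nonneg fun p => apply_nonneg v _)
      (prod_nonneg fun v _ => ?_)
    · refine prod_le_prod (fun v _ => pow_nonneg (hAnn v) _) fun v _ => ?_
      rw [← mul_pow, ← hAd v]
    · exact finprod_le_finprod (hasFiniteMulSupport_iSup_finitePlace hw)
        (fun v => Real.iSup_nonneg fun p => apply_nonneg v _)
        (hasFiniteMulSupport_iSup_finitePlace htne) fun v => iSup_wedge_le_finitePlace v γ δ
    · exact mul_nonneg (pow_nonneg (div_nonneg (hAnn v) (hBpos v).le) _)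
        (pow_nonneg (Real.iSup_nonneg fun a => apply_nonneg v _) _)
  -- the product over places is the product over embeddings of the distances
  have hfiber : ∏ v : InfinitePlace K, d v ^ v.mult = ∏ σ : K →+* ℂ, projDist (σ ∘ γ) (σ ∘ δ) := by
    rw [← Finset.prod_fiberwise univ (fun σ : K →+* ℂ => InfinitePlace.mk σ)]
    refine prod_congr rfl fun v _ => ?_
    rw [← InfinitePlace.card_filter_mk_eq v, ← prod_const]
    refine prod_congr rfl fun σ hσ => ?_
    rw [mem_filter] at hσ
    rw [projDist_comp_embedding, hσ.2]
  calc (1 : ℝ) ≤ mulHeight (wedge γ δ) := h1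
    _ ≤ (∏ v : InfinitePlace K, d v ^ v.mult) * mulHeight t := hwedge
    _ = mulHeight γ * mulHeight δ * ∏ σ : K →+* ℂ, projDist (σ ∘ γ) (σ ∘ δ) := by
        rw [hfiber, hHt]; ring

/-- **Liouville's inequality for the projective distance** (the core of Nguyen–Roy 2016,
Prop. 12). Let `K` be a number field, `γ, δ ∈ K^{m+1}` with `γ ∧ δ ≠ 0`, and `S` any finite set of
embeddings `K →+* ℂ`. Then `1 ≤ 2^{[K:ℚ]} H_K(γ) H_K(δ) ∏_{σ ∈ S} dist(σγ, σδ)`, where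
`H_K = Height.mulHeight` is the multiplicative height relative to `K` and `dist` the projective
distance `Nesterenko.projDist`. [cite: NguyenRoy2016, Prop. 12 (proof)] -/
theorem one_le_two_pow_mul_mulHeight_mul_prod_projDist {γ δ : Fin (m + 1) → K}
    (hw : wedge γ δ ≠ 0) (S : Finset (K →+* ℂ)) :
    1 ≤ (2 : ℝ) ^ Module.finrank ℚ K * mulHeight γ * mulHeight δ *
      ∏ σ ∈ S, projDist (σ ∘ γ) (σ ∘ δ) := by
  classical
  have hγ := left_ne_zero_of_wedge_ne_zero hw
  have hδ := right_ne_zero_of_wedge_ne_zero hw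
  have hle2 : ∀ σ : K →+* ℂ, projDist (σ ∘ γ) (σ ∘ δ) ≤ 2 := fun σ => by
    rw [projDist_comp_embedding]; exact iSup_wedge_div_le_two _ hγ hδ
  have hnn : ∀ σ : K →+* ℂ, 0 ≤ projDist (σ ∘ γ) (σ ∘ δ) := fun σ => projDist_nonneg _ _
  have hall := one_le_mulHeight_mul_prod_projDist hw
  rw [← prod_mul_prod_compl S] at hall
  have hcompl : ∏ σ ∈ Sᶜ, projDist (σ ∘ γ) (σ ∘ δ) ≤ (2 : ℝ) ^ Module.finrank ℚ K := by
    calc ∏ σ ∈ Sᶜ, projDist (σ ∘ γ) (σ ∘ δ) ≤ ∏ _σ ∈ Sᶜ, (2 : ℝ) :=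
          prod_le_prod (fun σ _ => hnn σ) fun σ _ => hle2 σ
      _ = 2 ^ Sᶜ.card := prod_const _
      _ ≤ 2 ^ Module.finrank ℚ K := by
          refine pow_le_pow_right₀ one_le_two ?_
          rw [← Embeddings.card K ℂ]
          exact card_le_univ _
  have hH : 0 ≤ mulHeight γ * mulHeight δ := mul_nonneg (mulHeight_pos _).le (mulHeight_pos _).le
  have hS : 0 ≤ ∏ σ ∈ S, projDist (σ ∘ γ) (σ ∘ δ) := prod_nonneg fun σ _ => hnn σ
  calc (1 : ℝ) ≤ mulHeight γ * mulHeight δ *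
        ((∏ σ ∈ S, projDist (σ ∘ γ) (σ ∘ δ)) * ∏ σ ∈ Sᶜ, projDist (σ ∘ γ) (σ ∘ δ)) := hall
    _ ≤ mulHeight γ * mulHeight δ * ((∏ σ ∈ S, projDist (σ ∘ γ) (σ ∘ δ)) * 2 ^ Module.finrank ℚ K) :=
        mul_le_mul_of_nonneg_left (mul_le_mul_of_nonneg_left hcompl hS) hH
    _ = _ := by ring

/-- **Liouville's inequality for the projective distance, logarithmic form**: for `γ ∧ δ ≠ 0` and
any finite set `S` of embeddings,
`−h_K(γ) − h_K(δ) − [K:ℚ] log 2 ≤ ∑_{σ ∈ S} log dist(σγ, σδ)` (`h_K = Height.logHeight`, the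
logarithmic height relative to `K`, i.e. `[K:ℚ]` times the absolute logarithmic Weil height `h_abs`
of the paper). This is the inequality
"`(1/|𝒪|) ∑ log dist(α, α*) ≥ −h_abs(γ) − h_abs(γ*) − log 2`" of the proof of Prop. 12, summed over
an orbit. [cite: NguyenRoy2016, Prop. 12 (proof)] -/
theorem neg_logHeight_le_sum_log_projDist {γ δ : Fin (m + 1) → K} (hw : wedge γ δ ≠ 0)
    (S : Finset (K →+* ℂ)) (hS : ∀ σ ∈ S, projDist (σ ∘ γ) (σ ∘ δ) ≠ 0) :
    -logHeight γ - logHeight δ - Module.finrank ℚ K * Real.log 2 ≤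
      ∑ σ ∈ S, Real.log (projDist (σ ∘ γ) (σ ∘ δ)) := by
  have h := one_le_two_pow_mul_mulHeight_mul_prod_projDist hw S
  have hpos : ∀ σ ∈ S, 0 < projDist (σ ∘ γ) (σ ∘ δ) := fun σ hσ =>
    lt_of_le_of_ne (projDist_nonneg _ _) (Ne.symm (hS σ hσ))
  have hprod : 0 < ∏ σ ∈ S, projDist (σ ∘ γ) (σ ∘ δ) := prod_pos hpos
  have hlog := Real.log_le_log one_pos h
  have h2n : (2 : ℝ) ^ Module.finrank ℚ K ≠ 0 := by positivity
  have hHγ := (mulHeight_pos γ).ne'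
  have hHδ := (mulHeight_pos δ).ne'
  rw [Real.log_one, Real.log_mul (mul_ne_zero (mul_ne_zero h2n hHγ) hHδ) hprod.ne',
    Real.log_mul (mul_ne_zero h2n hHγ) hHδ, Real.log_mul h2n hHγ, Real.log_pow,
    Real.log_prod (fun σ hσ => (hpos σ hσ).ne')] at hlog
  rw [logHeight_eq_log_mulHeight, logHeight_eq_log_mulHeight]
  linarith

end NguyenRoy

end Literature.NumberTheory.Transcendental
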